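import Literature.AnabelianGeometry.SemiGraphs.TemperedCoveringsLimitsProofs
import Literature.AnabelianGeometry.SemiGraphs.TemperedCoveringsComponentsProofs
import Mathlib.CategoryTheory.Adjunction.Limits
import HarnessLib

/-!
# [SemiAnbd] §3: `B^temp(G)` is closed under finite limits and countable colimits (G10 brick B0, part 2b)

Mochizuki, *Semi-graphs of anabelioids*, Publ. RIMS **42** (2006) 221–322, §3, manuscript
pp. 37–39 [cite: MochizukiSemiAnbd2006, §3 pp.37-39]: Definition 3.5 (ii) (`B^temp(G) ⊆ B^cov(G)`,
the tempered coverings, as corrected in [IUTchI] Rmk. 2.5.3 (v)) and Proposition 3.6 (ii)/(iv)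
("the category `B^temp(G)` is a connected temperoid"; "any morphism of semi-graphs of anabelioids …
induces a morphism of temperoids", the restriction `S ↦ S_v` to a constituent anabelioid being the
basic instance).  Proof-only companion (no definitions), over the componentwise (co)limits of
`TemperedCoveringsLimitsProofs` and the component bookkeeping of
`TemperedCoveringsComponentsProofs`:

* `CovObj.limit_point_ext` / `CovObj.colimit_point_surjective` — points of a finite limit are
  determined by their projections; points of a countable colimit come from the diagram;
* `CovObj.isTempered_of_isLimit` — a finite limit of tempered coverings is tempered (a component
  of the limit is split by the product of the finitely many finite coverings splitting its images);
* `CovObj.isTempered_of_isColimit` — a countable colimit of tempered coverings is tempered (a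
  component of the colimit is the image of a component of one term);
* hence (`BTempCat.hasFiniteLimits`, `BTempCat.hasColimitsOfShape`, …) `B^temp(G)` has the finite
  limits and countable colimits of a temperoid, created by the inclusion into `B^cov(G)`, and for
  every tempered fundamental group (chart) `c` the functor
  `c.equiv.inverse ⋙ ι ⋙ restrictV : B^temp(π₁^temp G) ⥤ B^temp(Π_v)` underlying the verticial
  homomorphisms of Theorem 3.7 (i) preserves them (`chartRestrictV_preservesFiniteLimits`, …), i.e.
  is a morphism of temperoids in the sense of Definition 3.1 (iii).

abc-iut G10 ladder infrastructure (brick B0, L3-lead 20:21:29Z).  No statement of the paper is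
strengthened.
-/

open CategoryTheory CategoryTheory.Limits Topology

namespace Literature.AnabelianGeometry.SemiGraphs

namespace ProfiniteSemiGraph

open Literature.AlgebraicGeometry.Frobenioids.QuasiTemperoid.BTempConnected (hom_ρ)

universe u

variable {𝒢 : ProfiniteSemiGraph.{u}}

namespace CovObj

/-! ### Points of limits and colimits -/

section Points

/-- In `B^temp(Π)`, the points of a finite limit are determined by their projections.
[cite: MochizukiSemiAnbd2006, Def 3.1(iii) p.33] -/
theorem bTemp_limit_point_ext {G : Type u} [Group G] [TopologicalSpace G] {J : Type}
    [SmallCategory J] [FinCategory J] {K : J ⥤ BTemp G} {c : Cone K} (hc : IsLimit c)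
    (t t' : c.pt.obj.V) (h : ∀ j, ((c.π.app j).hom.hom t : (K.obj j).obj.V) = (c.π.app j).hom.hom t') :
    t = t' := by
  haveI := temperedAction_isClosedUnderLimitsOfShape (G := G) J
  have hc' := isLimitOfPreserves (Action.forget (Type u) G)
    (isLimitOfPreserves (temperedAction G).ι hc)
  apply (Types.isLimitEquivSections hc').injective
  apply Subtype.ext
  funext j
  exact h j

/-- In `B^temp(Π)`, the points of a countable colimit come from the terms of the diagram.
[cite: MochizukiSemiAnbd2006, Def 3.1(iii) p.33] -/
theorem bTemp_colimit_point_surjective {G : Type u} [Group G] [TopologicalSpace G]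
    [IsTopologicalGroup G] {J : Type} [SmallCategory J] [CountableCategory J] {K : J ⥤ BTemp G}
    {c : Cocone K} (hc : IsColimit c) (t : c.pt.obj.V) :
    ∃ (j : J) (y : (K.obj j).obj.V), ((c.ι.app j).hom.hom y : c.pt.obj.V) = t := by
  haveI := temperedAction_isClosedUnderColimitsOfShape (G := G) J
  have hc' := isColimitOfPreserves (Action.forget (Type u) G)
    (isColimitOfPreserves (temperedAction G).ι hc)
  exact Types.jointly_surjective_of_isColimit hc' t

variable {J : Type} [SmallCategory J]

/-- The vertex points of a finite limit in `B^cov(G)` are determined by their projections.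
[cite: MochizukiSemiAnbd2006, §3 p.36] -/
theorem limit_point_extV [FinCategory J] {K : J ⥤ CovObj 𝒢} {c : Cone K} (hc : IsLimit c)
    (v : 𝒢.graph.Vertex) (t t' : (c.pt.SV v).obj.V)
    (h : ∀ j, (((c.π.app j).fV v).hom.hom t : ((K.obj j).SV v).obj.V) = ((c.π.app j).fV v).hom.hom t') :
    t = t' :=
  haveI := preservesLimitsOfShape_restrictV (J := J) 𝒢 v
  bTemp_limit_point_ext (isLimitOfPreserves (restrictV 𝒢 v) hc) t t' h

/-- The edge points of a finite limit in `B^cov(G)` are determined by their projections.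
[cite: MochizukiSemiAnbd2006, §3 p.36] -/
theorem limit_point_extE [FinCategory J] {K : J ⥤ CovObj 𝒢} {c : Cone K} (hc : IsLimit c)
    (e : 𝒢.graph.Edge) (t t' : (c.pt.SE e).obj.V)
    (h : ∀ j, (((c.π.app j).fE e).hom.hom t : ((K.obj j).SE e).obj.V) = ((c.π.app j).fE e).hom.hom t') :
    t = t' :=
  haveI := preservesLimitsOfShape_restrictE (J := J) 𝒢 e
  bTemp_limit_point_ext (isLimitOfPreserves (restrictE 𝒢 e) hc) t t' h

/-- The points of a countable colimit in `B^cov(G)` come from the terms of the diagram.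
[cite: MochizukiSemiAnbd2006, §3 p.36] -/
theorem colimit_point_surjective [CountableCategory J] {K : J ⥤ CovObj 𝒢} {c : Cocone K}
    (hc : IsColimit c) (p : c.pt.Point) :
    ∃ (j : J) (p' : (K.obj j).Point),
      Sum.map (Sigma.map id fun v x => ((c.ι.app j).fV v).hom.hom x)
        (Sigma.map id fun e x => ((c.ι.app j).fE e).hom.hom x) p' = p := by
  rcases p with ⟨v, t⟩ | ⟨e, t⟩
  · haveI := preservesColimitsOfShape_restrictV (J := J) 𝒢 v
    obtain ⟨j, y, hy⟩ :=
      bTemp_colimit_point_surjective (isColimitOfPreserves (restrictV 𝒢 v) hc) t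
    exact ⟨j, Sum.inl ⟨v, y⟩, congrArg (fun z => (Sum.inl ⟨v, z⟩ : c.pt.Point)) hy⟩
  · haveI := preservesColimitsOfShape_restrictE (J := J) 𝒢 e
    obtain ⟨j, y, hy⟩ :=
      bTemp_colimit_point_surjective (isColimitOfPreserves (restrictE 𝒢 e) hc) t
    exact ⟨j, Sum.inr ⟨e, y⟩, congrArg (fun z => (Sum.inr ⟨e, z⟩ : c.pt.Point)) hy⟩

end Points

/-! ### `B^temp(G)` is closed under finite limits -/

section TemperedLimits

variable {J : Type} [SmallCategory J]

/-- A finite product of finite coverings with nonempty fibres is a finite covering with nonempty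
fibres dominating each factor. [cite: MochizukiSemiAnbd2006, Def 3.5(ii) p.37] -/
theorem exists_finite_dominating {ι : Type} [Finite ι] (F : ι → CovObj 𝒢)
    (hfin : ∀ i, (F i).IsFinite) (hne : ∀ i, (F i).HasNonemptyFibres) :
    ∃ (P : CovObj 𝒢) (_ : ∀ i, P ⟶ F i), P.IsFinite ∧ P.HasNonemptyFibres := by
  classical
  letI : Fintype ι := Fintype.ofFinite ι
  obtain ⟨c, hc, hV, hE⟩ := exists_limitCone (Discrete.functor F)
  refine ⟨c.pt, fun i => c.π.app ⟨i⟩, ⟨fun v => ?_, fun e => ?_⟩, ⟨fun v => ?_, fun e => ?_⟩⟩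
  · -- vertex fibres are finite: they inject into the product of the finite fibres
    haveI : ∀ i : ι, Finite ((((Discrete.functor F).obj ⟨i⟩).SV v).obj.V) :=
      fun i => (hfin i).finite_V v
    refine Finite.of_injective (fun (t : (c.pt.SV v).obj.V) (i : ι) =>
      (((c.π.app ⟨i⟩).fV v).hom.hom t : (((Discrete.functor F).obj ⟨i⟩).SV v).obj.V))
      fun t t' htt' => ?_
    exact limit_point_extV hc v t t' fun ⟨i⟩ => congrFun htt' i
  · haveI : ∀ i : ι, Finite ((((Discrete.functor F).obj ⟨i⟩).SE e).obj.V) :=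
      fun i => (hfin i).finite_E e
    refine Finite.of_injective (fun (t : (c.pt.SE e).obj.V) (i : ι) =>
      (((c.π.app ⟨i⟩).fE e).hom.hom t : (((Discrete.functor F).obj ⟨i⟩).SE e).obj.V))
      fun t t' htt' => ?_
    exact limit_point_extE hc e t t' fun ⟨i⟩ => congrFun htt' i
  · -- vertex fibres are nonempty: a family of points is a section of the discrete diagram
    haveI := temperedAction_isClosedUnderLimitsOfShape (G := 𝒢.Gv v) (Discrete ι)
    have hc' := isLimitOfPreserves (Action.forget (Type u) (𝒢.Gv v))
      (isLimitOfPreserves (temperedAction (𝒢.Gv v)).ι (hV v).some)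
    let x : ∀ i, ((F i).SV v).obj.V := fun i => ((hne i).nonempty_V v).some
    refine ⟨(Types.isLimitEquivSections hc').symm ⟨fun i => x i.as, ?_⟩⟩
    rintro ⟨i⟩ ⟨i'⟩ ⟨⟨h⟩⟩
    cases h
    simp
  · haveI := temperedAction_isClosedUnderLimitsOfShape (G := 𝒢.Ge e) (Discrete ι)
    have hc' := isLimitOfPreserves (Action.forget (Type u) (𝒢.Ge e))
      (isLimitOfPreserves (temperedAction (𝒢.Ge e)).ι (hE e).some)
    let x : ∀ i, ((F i).SE e).obj.V := fun i => ((hne i).nonempty_E e).some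
    refine ⟨(Types.isLimitEquivSections hc').symm ⟨fun i => x i.as, ?_⟩⟩
    rintro ⟨i⟩ ⟨i'⟩ ⟨⟨h⟩⟩
    cases h
    simp

/-- Splittings pull back along dominating morphisms: if `P → F` and `F` splits `S` at `q`, so does
`P` (stabilisers of points of `P` are contained in stabilisers of their images).
[cite: MochizukiSemiAnbd2006, Def 3.5(ii) p.37] -/
theorem splitsAt_of_hom {P F S : CovObj 𝒢} (π : P ⟶ F) {q : S.Point} (hq : F.SplitsAt S q) :
    P.SplitsAt S q := by
  rcases q with ⟨v, s⟩ | ⟨e, s⟩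
  · change ∀ (x : (P.SV v).obj.V) (g : 𝒢.Gv v), (P.SV v).obj.ρ g x = x → (S.SV v).obj.ρ g s = s
    intro x g hx
    refine hq ((π.fV v).hom.hom x) g ?_
    rw [← hom_ρ, hx]
  · change ∀ (x : (P.SE e).obj.V) (g : 𝒢.Ge e), (P.SE e).obj.ρ g x = x → (S.SE e).obj.ρ g s = s
    intro x g hx
    refine hq ((π.fE e).hom.hom x) g ?_
    rw [← hom_ρ, hx]

/-- **A finite limit of tempered coverings is tempered** ([SemiAnbd] Def. 3.5 (ii) / Prop. 3.6 (ii):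
`B^temp(G)` has the finite limits of `B^cov(G)`): the component of a point `p` of the limit maps
into the components of its projections `p_j`; a finite covering dominating the finitely many
coverings splitting those components splits the limit at every point of the component of `p`,
because points of the limit are determined by their projections.
[cite: MochizukiSemiAnbd2006, Prop 3.6(ii) p.38] -/
theorem isTempered_of_isLimit [FinCategory J] {K : J ⥤ CovObj 𝒢} {c : Cone K} (hc : IsLimit c)
    (hK : ∀ j, (K.obj j).IsTempered) : c.pt.IsTempered := by
  classical
  intro p
  -- the finite coverings splitting the components of the projections of `p`
  let pm : ∀ j, c.pt.Point → (K.obj j).Point := fun j =>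
    Sum.map (Sigma.map id fun v x => ((c.π.app j).fV v).hom.hom x)
      (Sigma.map id fun e x => ((c.π.app j).fE e).hom.hom x)
  have hF : ∀ j, ∃ F : CovObj 𝒢, F.IsFinite ∧ F.HasNonemptyFibres ∧
      ∀ q, (K.obj j).SameComponent (pm j p) q → F.SplitsAt (K.obj j) q := fun j => hK j (pm j p)
  choose F hFfin hFne hFsplit using hF
  obtain ⟨P, π, hPfin, hPne⟩ := exists_finite_dominating F hFfin hFne
  refine ⟨P, hPfin, hPne, fun q hq => ?_⟩
  -- at a point `q` of the component of `p`
  have hsplit : ∀ j, (F j).SplitsAt (K.obj j) (pm j q) := fun j =>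
    hFsplit j _ (sameComponent_map (c.π.app j) hq)
  rcases q with ⟨v, s⟩ | ⟨e, s⟩
  · intro x g hx
    apply limit_point_extV hc v
    intro j
    exact (hom_ρ ((c.π.app j).fV v) g s).trans (splitsAt_of_hom (π j) (hsplit j) x g hx)
  · intro x g hx
    apply limit_point_extE hc e
    intro j
    exact (hom_ρ ((c.π.app j).fE e) g s).trans (splitsAt_of_hom (π j) (hsplit j) x g hx)

/-- **A countable colimit of tempered coverings is tempered** ([SemiAnbd] Def. 3.5 (ii) / Prop. 3.6
(ii)): a point of the colimit comes from a point `p'` of some term `K_j`; the component of its image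
is the image of the component of `p'` (images of components are components), and the finite
covering splitting that component of `K_j` splits its image.
[cite: MochizukiSemiAnbd2006, Prop 3.6(ii) p.38] -/
theorem isTempered_of_isColimit [CountableCategory J] {K : J ⥤ CovObj 𝒢} {c : Cocone K}
    (hc : IsColimit c) (hK : ∀ j, (K.obj j).IsTempered) : c.pt.IsTempered := by
  intro p
  obtain ⟨j, p', rfl⟩ := colimit_point_surjective hc p
  obtain ⟨F, hFfin, hFne, hFsplit⟩ := hK j p'
  refine ⟨F, hFfin, hFne, fun q hq => ?_⟩
  obtain ⟨q', hq', rfl⟩ := exists_preimage_of_sameComponent (c.ι.app j) p' q hq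
  exact splitsAt_map (c.ι.app j) F (hFsplit q' hq')

end TemperedLimits

end CovObj

/-! ### `B^temp(G)` has finite limits and countable colimits; the chart restriction functors -/

section BTempCat

/-- The tempered objects are closed under finite limits in `B^cov(G)`.
[cite: MochizukiSemiAnbd2006, Prop 3.6(ii) p.38] -/
theorem isTempered_isClosedUnderLimitsOfShape (J : Type) [SmallCategory J] [FinCategory J] :
    ObjectProperty.IsClosedUnderLimitsOfShape (fun S : CovObj 𝒢 => S.IsTempered) J :=
  ⟨fun _ hX => by
    obtain ⟨h⟩ := hX
    exact CovObj.isTempered_of_isLimit h.isLimit h.prop_diag_obj⟩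

/-- The tempered objects are closed under countable colimits in `B^cov(G)`.
[cite: MochizukiSemiAnbd2006, Prop 3.6(ii) p.38] -/
theorem isTempered_isClosedUnderColimitsOfShape (J : Type) [SmallCategory J]
    [CountableCategory J] :
    ObjectProperty.IsClosedUnderColimitsOfShape (fun S : CovObj 𝒢 => S.IsTempered) J :=
  ⟨fun _ hX => by
    obtain ⟨h⟩ := hX
    exact CovObj.isTempered_of_isColimit h.isColimit h.prop_diag_obj⟩

/-- `B^temp(G)` has finite limits (created by `B^temp(G) ↪ B^cov(G)`).
[cite: MochizukiSemiAnbd2006, Prop 3.6(ii) p.38] -/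
theorem BTempCat.hasLimitsOfShape (J : Type) [SmallCategory J] [FinCategory J] :
    HasLimitsOfShape J (BTempCat 𝒢) :=
  haveI := isTempered_isClosedUnderLimitsOfShape (𝒢 := 𝒢) J
  haveI := CovObj.hasLimitsOfShape (𝒢 := 𝒢) (J := J)
  inferInstance

/-- `B^temp(G)` has finite limits. [cite: MochizukiSemiAnbd2006, Prop 3.6(ii) p.38] -/
theorem BTempCat.hasFiniteLimits : HasFiniteLimits (BTempCat 𝒢) :=
  ⟨fun J _ _ => BTempCat.hasLimitsOfShape (𝒢 := 𝒢) J⟩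

/-- `B^temp(G)` has countable colimits (created by `B^temp(G) ↪ B^cov(G)`).
[cite: MochizukiSemiAnbd2006, Prop 3.6(ii) p.38] -/
theorem BTempCat.hasColimitsOfShape (J : Type) [SmallCategory J] [CountableCategory J] :
    HasColimitsOfShape J (BTempCat 𝒢) :=
  haveI := isTempered_isClosedUnderColimitsOfShape (𝒢 := 𝒢) J
  haveI := CovObj.hasColimitsOfShape (𝒢 := 𝒢) (J := J)
  inferInstance

/-- For every tempered fundamental group (chart) `c` of `G` and every vertex `v`, the functor
`B^temp(π₁^temp(G)) ⥤ B^temp(Π_v)` underlying the verticial homomorphisms — transport along the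
chart followed by `S ↦ S_v` — preserves finite limits. [cite: MochizukiSemiAnbd2006, Thm 3.7(i) p.40] -/
theorem chartRestrictV_preservesLimitsOfShape (c : TemperedPiChart 𝒢) (v : 𝒢.graph.Vertex)
    (J : Type) [SmallCategory J] [FinCategory J] :
    PreservesLimitsOfShape J (c.equiv.inverse ⋙ ObjectProperty.ι _ ⋙ restrictV 𝒢 v) := by
  haveI := isTempered_isClosedUnderLimitsOfShape (𝒢 := 𝒢) J
  haveI := CovObj.hasLimitsOfShape (𝒢 := 𝒢) (J := J)
  haveI := CovObj.preservesLimitsOfShape_restrictV (J := J) 𝒢 v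
  infer_instance

/-- The same functor preserves countable colimits. [cite: MochizukiSemiAnbd2006, Thm 3.7(i) p.40] -/
theorem chartRestrictV_preservesColimitsOfShape (c : TemperedPiChart 𝒢) (v : 𝒢.graph.Vertex)
    (J : Type) [SmallCategory J] [CountableCategory J] :
    PreservesColimitsOfShape J (c.equiv.inverse ⋙ ObjectProperty.ι _ ⋙ restrictV 𝒢 v) := by
  haveI := isTempered_isClosedUnderColimitsOfShape (𝒢 := 𝒢) J
  haveI := CovObj.hasColimitsOfShape (𝒢 := 𝒢) (J := J)
  haveI := CovObj.preservesColimitsOfShape_restrictV (J := J) 𝒢 v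
  infer_instance

/-- Edge version: the functor underlying the edge homomorphisms preserves finite limits.
[cite: MochizukiSemiAnbd2006, Thm 3.7(iii) p.41] -/
theorem chartRestrictE_preservesLimitsOfShape (c : TemperedPiChart 𝒢) (e : 𝒢.graph.Edge)
    (J : Type) [SmallCategory J] [FinCategory J] :
    PreservesLimitsOfShape J (c.equiv.inverse ⋙ ObjectProperty.ι _ ⋙ restrictE 𝒢 e) := by
  haveI := isTempered_isClosedUnderLimitsOfShape (𝒢 := 𝒢) J
  haveI := CovObj.hasLimitsOfShape (𝒢 := 𝒢) (J := J)
  haveI := CovObj.preservesLimitsOfShape_restrictE (J := J) 𝒢 e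
  infer_instance

/-- Edge version, countable colimits. [cite: MochizukiSemiAnbd2006, Thm 3.7(iii) p.41] -/
theorem chartRestrictE_preservesColimitsOfShape (c : TemperedPiChart 𝒢) (e : 𝒢.graph.Edge)
    (J : Type) [SmallCategory J] [CountableCategory J] :
    PreservesColimitsOfShape J (c.equiv.inverse ⋙ ObjectProperty.ι _ ⋙ restrictE 𝒢 e) := by
  haveI := isTempered_isClosedUnderColimitsOfShape (𝒢 := 𝒢) J
  haveI := CovObj.hasColimitsOfShape (𝒢 := 𝒢) (J := J)
  haveI := CovObj.preservesColimitsOfShape_restrictE (J := J) 𝒢 e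
  infer_instance

/-- **The restriction through a chart is a morphism of temperoids** (Definition 3.1 (iii)): for
every chart `c` and vertex `v`, `c.equiv.inverse ⋙ ι ⋙ restrictV` preserves finite limits and
countable colimits — the property that makes it an object of `TemperoidHomCat`, i.e. the input of
Proposition 3.2 producing the verticial homomorphism `Π_v → π₁^temp(G)` of Theorem 3.7 (i).
[cite: MochizukiSemiAnbd2006, Thm 3.7(i) p.40] -/
theorem chartRestrictV_isTemperoidHom (c : TemperedPiChart 𝒢) (v : 𝒢.graph.Vertex) :
    PreservesFiniteLimits (c.equiv.inverse ⋙ ObjectProperty.ι _ ⋙ restrictV 𝒢 v) ∧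
      ∀ (J : Type) [SmallCategory J] [CountableCategory J],
        PreservesColimitsOfShape J (c.equiv.inverse ⋙ ObjectProperty.ι _ ⋙ restrictV 𝒢 v) :=
  ⟨⟨fun J _ _ => chartRestrictV_preservesLimitsOfShape c v J⟩,
    fun J _ _ => chartRestrictV_preservesColimitsOfShape c v J⟩

/-- The same for an edge: `c.equiv.inverse ⋙ ι ⋙ restrictE` is a morphism of temperoids (input of
Proposition 3.2 for the edge homomorphisms of Theorem 3.7 (iii)).
[cite: MochizukiSemiAnbd2006, Thm 3.7(iii) p.41] -/
theorem chartRestrictE_isTemperoidHom (c : TemperedPiChart 𝒢) (e : 𝒢.graph.Edge) :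
    PreservesFiniteLimits (c.equiv.inverse ⋙ ObjectProperty.ι _ ⋙ restrictE 𝒢 e) ∧
      ∀ (J : Type) [SmallCategory J] [CountableCategory J],
        PreservesColimitsOfShape J (c.equiv.inverse ⋙ ObjectProperty.ι _ ⋙ restrictE 𝒢 e) :=
  ⟨⟨fun J _ _ => chartRestrictE_preservesLimitsOfShape c e J⟩,
    fun J _ _ => chartRestrictE_preservesColimitsOfShape c e J⟩

end BTempCat

end ProfiniteSemiGraph

end Literature.AnabelianGeometry.SemiGraphs
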